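import Literature.AlgebraicGeometry.ShimuraVarieties.UnitaryBallAutomorphicForms
import Literature.NumberTheory.Automorphic.WeightFormsQuotient
import HarnessLib

/-!
# Automorphic forms on the ball as functions on a group mapping to `U(2,1)`

Topic `AlgebraicGeometry/ShimuraVarieties`; namespace
`Literature.AlgebraicGeometry.ShimuraVarieties.BallForms` (continues `UnitaryBallAutomorphicForms`).

The FORMS-ONLY half of the dictionary "holomorphic automorphic form on `𝔹²` ↦ function on the
arithmetic quotient". The arithmetic group of a Picard modular surface lives in
`G_∞ = U(2,1) × (compact)` (or in an adelic group projecting onto it), not in `U(2,1)` itself; so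
everything is written over an abstract group `G₁` with a homomorphism `pr : G₁ →* U21`
(tree `UnitBallU21`), a subgroup `Λ ≤ G₁`, and its image `Λ.map pr ≤ U(2,1)`:

* §1 the **group lift** `groupLift pr k F : G₁ → V`, `g ↦ j(pr g, x₀)ᵏ • F (pr g • x₀)` — the tree's
  `AutomorphyFactor.toGroupFun` for the canonical cocycle `canonicalCocycle V k`
  (`UnitaryBallAutomorphicForms`) composed with `pr`; `ℂ`-linear in `F` (`groupLiftₗ`);
* §2 invariance: for `F ∈ factorForms (Λ.map pr) (canonicalCocycle V k)` the lift is LEFT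
  `Λ`-invariant (`groupLift_mul_left`), and for every `F` it transforms on the right under
  `pr⁻¹(K)`, `K = Stab(x₀)`, through the character `j(pr κ, x₀)ᵏ` (`groupLift_mul_right`);
* §3 continuity: `G₁` topological, `pr` continuous, `F` holomorphic (hence continuous) ⇒
  `groupLift pr k F` continuous (`continuous_groupLift`);
* §4 descent: the `ℂ`-linear map
  `groupLiftCM pr k Λ hpr : holFactorForms (Λ.map pr) (canonicalCocycle V k) →ₗ[ℂ] C(G₁ ⧸ Λ, V)`,
  `F ↦ (⟦g⟧ ↦ groupLift pr k F g⁻¹)` (the INVERSION convention of the tree's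
  `WeightForms.quotInv` / `toQuotCM`, `WeightFormsQuotient`), with the pointwise formula
  `groupLiftCM_apply_coe` and injectivity when `pr` is surjective (`groupLiftCM_injective`);
* §5 the integrand handed to the measure side: for scalar forms (`V = ℂ`)
  `conj (groupLiftCM … F′ ⟦g⟧) * groupLiftCM … F ⟦g⟧ = liftPairing k F′ F (pr g⁻¹)` with
  `liftPairing k F′ F u := conj (j(u,x₀)ᵏ F′(u x₀)) * (j(u,x₀)ᵏ F(u x₀))` a function on `U(2,1)`
  (`conj_groupLiftCM_mul_groupLiftCM`), i.e. the `(U)`-integrand of the unfolding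
  (`LevelOrbitPiecePairing`) is a function of `pr g` — the input of the push-forward along `pr`.

Everything is elementary and PROVED (kernel only, no records; cite tags are provenance labels).
Sources: Borel 1997 §5.14 (automorphy factors and the passage form ↦ function on the group);
Getz–Hahn 2024 Def. 6.5 / §6.3 (left-invariant functions, right translation) — conventions as in
`WeightFormsQuotient`. Deliberately NOT here: measures, the push-forward of fundamental domains
along `pr` (`Literature/MeasureTheory/Group`), the Petersson formula, the instance
`pr : G_∞ →* U(2,1)` of the unitary lane.
-/

open MulAction Topology ComplexConjugate
open Literature.Geometry.ComplexHyperbolic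
open Literature.Geometry.ComplexHyperbolic.BallModel (U21 Ball x₀)
open Literature.NumberTheory.Automorphic
open Literature.NumberTheory.Automorphic.AutomorphyFactor

noncomputable section

namespace Literature.AlgebraicGeometry.ShimuraVarieties

namespace BallForms

variable {G₁ : Type*} [Group G₁]
variable {V : Type*} [NormedAddCommGroup V] [NormedSpace ℂ V]

/-! ## §1 The group lift -/

/-- **Group lift** of a `V`-valued function on the ball along `pr : G₁ →* U(2,1)`:
`groupLift pr k F g = j(pr g, x₀)ᵏ • F (pr g • x₀)`, i.e. `toGroupFun (canonicalCocycle V k) x₀ F ∘ pr`.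
[cite: Borel1997, §5.14] -/
def groupLift (pr : G₁ →* U21) (k : ℕ) (F : Ball → V) : G₁ → V :=
  toGroupFun (canonicalCocycle V k) x₀ F ∘ pr

variable (pr : G₁ →* U21) (k : ℕ)

/-- `groupLift pr k F g = j(pr g, x₀)ᵏ • F (pr g • x₀)`. [folklore] -/
@[simp] theorem groupLift_apply (F : Ball → V) (g : G₁) :
    groupLift pr k F g = canonicalFactor (pr g) x₀ ^ k • F (pr g • x₀) := by
  simp [groupLift]

/-- `groupLift pr k F = toGroupFun (canonicalCocycle V k) x₀ F ∘ pr`. [folklore] -/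
theorem groupLift_eq_comp (F : Ball → V) :
    groupLift pr k F = toGroupFun (canonicalCocycle V k) x₀ F ∘ pr := rfl

/-- The group lift is additive in `F`. [folklore] -/
theorem groupLift_add (F F' : Ball → V) :
    groupLift pr k (F + F') = groupLift pr k F + groupLift pr k F' := by
  ext g; simp [smul_add]

/-- The group lift is homogeneous in `F`. [folklore] -/
theorem groupLift_smul (c : ℂ) (F : Ball → V) :
    groupLift pr k (c • F) = c • groupLift pr k F := by
  ext g; simp [smul_comm c]

/-- `groupLift pr k 0 = 0`. [folklore] -/
@[simp] theorem groupLift_zero : groupLift pr k (0 : Ball → V) = 0 := by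
  ext g; simp

/-- The group lift as a `ℂ`-linear map `(Ball → V) →ₗ[ℂ] (G₁ → V)`. [folklore] -/
def groupLiftₗ : (Ball → V) →ₗ[ℂ] (G₁ → V) where
  toFun := groupLift pr k
  map_add' := groupLift_add pr k
  map_smul' := groupLift_smul pr k

/-- `groupLiftₗ pr k F = groupLift pr k F`. [folklore] -/
@[simp] theorem groupLiftₗ_apply (F : Ball → V) : groupLiftₗ pr k F = groupLift pr k F := rfl

/-! ## §2 Invariance -/

variable {pr k}

/-- **Left `Λ`-invariance**: if `F` is a form for `Λ.map pr`, then `groupLift pr k F (λ g) =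
groupLift pr k F g` for `λ ∈ Λ`. [cite: Borel1997, §5.14] -/
theorem groupLift_mul_left {Λ : Subgroup G₁} {F : Ball → V}
    (hF : F ∈ factorForms (Λ.map pr) (canonicalCocycle V k)) {l : G₁} (hl : l ∈ Λ) (g : G₁) :
    groupLift pr k F (l * g) = groupLift pr k F g := by
  have h := (toGroupFun_mem (isPullbackCocycle_canonicalCocycle V k) x₀ hF).1 (pr l)
    (Subgroup.mem_map_of_mem pr hl) (pr g)
  simpa [groupLift, map_mul] using h

/-- The left-invariance hypothesis in the form consumed by `WeightForms.quotInv`. [folklore] -/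
theorem groupLift_leftInvariant {Λ : Subgroup G₁} {F : Ball → V}
    (hF : F ∈ factorForms (Λ.map pr) (canonicalCocycle V k)) :
    ∀ l ∈ Λ, ∀ g, groupLift pr k F (l * g) = groupLift pr k F g :=
  fun _ hl g ↦ groupLift_mul_left hF hl g

/-- **Right `K`-type**: for `κ ∈ G₁` with `pr κ ∈ Stab(x₀)`,
`groupLift pr k F (g κ) = j(pr κ, x₀)ᵏ • groupLift pr k F g` (any `F`). [cite: Borel1997, §5.14] -/
theorem groupLift_mul_right {F : Ball → V} {κ : G₁} (hκ : pr κ • x₀ = x₀) (g : G₁) :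
    groupLift pr k F (g * κ) = canonicalFactor (pr κ) x₀ ^ k • groupLift pr k F g := by
  rw [groupLift_apply, groupLift_apply, map_mul, mul_smul, hκ, canonicalFactor_mul, mul_pow,
    mul_smul, hκ]

/-- At the base point: `groupLift pr k F g = j(pr g, x₀)ᵏ • F (pr g • x₀)`, so `F (pr g • x₀)` is
recovered as `(j(pr g, x₀)ᵏ)⁻¹ • groupLift pr k F g`. [folklore] -/
theorem apply_smul_x₀_eq (F : Ball → V) (g : G₁) :
    F (pr g • x₀) = (canonicalFactor (pr g) x₀ ^ k)⁻¹ • groupLift pr k F g := by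
  rw [groupLift_apply, smul_smul, inv_mul_cancel₀ (pow_ne_zero k (canonicalFactor_ne_zero _ _)),
    one_smul]

/-! ## §3 Continuity -/

section Continuity

variable [TopologicalSpace G₁]

/-- The group lift of a continuous `F` along a continuous `pr` is continuous. [folklore] -/
theorem continuous_groupLift_of_continuous {pr : G₁ →* U21} (hpr : Continuous pr) (k : ℕ)
    {F : Ball → V} (hF : Continuous F) : Continuous (groupLift pr k F) := by
  have h : Continuous (toGroupFun (canonicalCocycle V k) x₀ F) := by
    refine continuous_toGroupFun_scalarCocycle ?_ hF
    exact (continuous_canonicalFactor x₀).pow k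
  exact h.comp hpr

/-- The group lift of a HOLOMORPHIC `F` along a continuous `pr` is continuous. [folklore] -/
theorem continuous_groupLift {pr : G₁ →* U21} (hpr : Continuous pr) (k : ℕ) {F : Ball → V}
    (hF : F ∈ holomorphic V) : Continuous (groupLift pr k F) :=
  continuous_groupLift_of_continuous hpr k (continuous_of_mem_holomorphic hF)

end Continuity

/-! ## §4 Descent to `C(G₁ ⧸ Λ, V)` -/

section Descent

variable [TopologicalSpace G₁] [IsTopologicalGroup G₁]
variable (pr k)
variable (Λ : Subgroup G₁) (hpr : Continuous pr)

/-- **The descended lift**: `F ↦ (⟦g⟧ ↦ groupLift pr k F g⁻¹)`, a `ℂ`-linear map from holomorphic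
forms for `Λ.map pr` to continuous functions on Mathlib's quotient `G₁ ⧸ Λ` (inversion convention
of `WeightForms.quotInv`). [cite: Borel1997, §5.14] -/
def groupLiftCM :
    holFactorForms (Λ.map pr) (canonicalCocycle V k) →ₗ[ℂ] C(G₁ ⧸ Λ, V) where
  toFun F := ⟨WeightForms.quotInv Λ (groupLift pr k (F : Ball → V))
      (groupLift_leftInvariant (mem_holFactorForms_iff.mp F.2).1),
    WeightForms.continuous_quotInv (continuous_groupLift hpr k (mem_holFactorForms_iff.mp F.2).2)⟩
  map_add' F F' := by
    ext x
    induction x using QuotientGroup.induction_on with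
    | H g => simp [groupLift_add]
  map_smul' c F := by
    ext x
    induction x using QuotientGroup.induction_on with
    | H g => simp [groupLift_smul]

variable {pr k Λ hpr}

/-- `groupLiftCM … F ⟦g⟧ = groupLift pr k F g⁻¹`. [folklore] -/
@[simp] theorem groupLiftCM_apply_coe (F : holFactorForms (Λ.map pr) (canonicalCocycle V k))
    (g : G₁) : groupLiftCM pr k Λ hpr F (g : G₁ ⧸ Λ) = groupLift pr k (F : Ball → V) g⁻¹ := rfl

/-- The lift is recovered from its descent: `groupLift pr k F g = groupLiftCM … F ⟦g⁻¹⟧`. [folklore] -/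
theorem groupLift_eq_groupLiftCM_coe_inv (F : holFactorForms (Λ.map pr) (canonicalCocycle V k))
    (g : G₁) : groupLift pr k (F : Ball → V) g = groupLiftCM pr k Λ hpr F ((g⁻¹ : G₁) : G₁ ⧸ Λ) := by
  rw [groupLiftCM_apply_coe, inv_inv]

/-- **Injectivity** of the descended lift when `pr` is surjective (`U(2,1)` acts transitively on
the ball, so `F` is determined by `g ↦ F (pr g • x₀)`). [folklore] -/
theorem groupLiftCM_injective (hsurj : Function.Surjective pr) :
    Function.Injective (groupLiftCM pr k Λ hpr (V := V)) := by
  intro F F' h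
  apply Subtype.ext
  funext z
  obtain ⟨u, hu⟩ := BallModel.exists_smul_x₀_eq z
  obtain ⟨g, rfl⟩ := hsurj u
  rw [← hu, apply_smul_x₀_eq (k := k) (F : Ball → V) g, apply_smul_x₀_eq (k := k) (F' : Ball → V) g,
    groupLift_eq_groupLiftCM_coe_inv (hpr := hpr) F g,
    groupLift_eq_groupLiftCM_coe_inv (hpr := hpr) F' g, h]

end Descent

/-! ## §5 The scalar integrand -/

section Scalar

/-- The pairing integrand on `U(2,1)` of two scalar functions on the ball in weight `k`:
`liftPairing k F′ F u = conj (j(u,x₀)ᵏ F′(u x₀)) * (j(u,x₀)ᵏ F(u x₀))`. [folklore] -/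
def liftPairing (k : ℕ) (F' F : Ball → ℂ) (u : U21) : ℂ :=
  conj (toGroupFun (canonicalCocycle ℂ k) x₀ F' u) * toGroupFun (canonicalCocycle ℂ k) x₀ F u

/-- `liftPairing k F′ F u = conj (j(u,x₀)ᵏ * F′ (u • x₀)) * (j(u,x₀)ᵏ * F (u • x₀))`. [folklore] -/
theorem liftPairing_apply (k : ℕ) (F' F : Ball → ℂ) (u : U21) :
    liftPairing k F' F u =
      conj (canonicalFactor u x₀ ^ k * F' (u • x₀)) * (canonicalFactor u x₀ ^ k * F (u • x₀)) := by
  simp [liftPairing]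

/-- Along `pr`, the pointwise pairing of two lifts is `liftPairing` evaluated at `pr g`. [folklore] -/
theorem conj_groupLift_mul_groupLift (pr : G₁ →* U21) (k : ℕ) (F' F : Ball → ℂ) (g : G₁) :
    conj (groupLift pr k F' g) * groupLift pr k F g = liftPairing k F' F (pr g) := rfl

variable [TopologicalSpace G₁] [IsTopologicalGroup G₁]
variable {pr : G₁ →* U21} {k : ℕ} {Λ : Subgroup G₁} {hpr : Continuous pr}

/-- **The `(U)`-integrand is a function of `pr g`**: on the quotient,
`conj (groupLiftCM … F′ ⟦g⟧) * groupLiftCM … F ⟦g⟧ = liftPairing k F′ F (pr g⁻¹)` — the shape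
consumed by the push-forward of fundamental domains along `pr`. [folklore] -/
theorem conj_groupLiftCM_mul_groupLiftCM
    (F' F : holFactorForms (Λ.map pr) (canonicalCocycle ℂ k)) (g : G₁) :
    conj (groupLiftCM pr k Λ hpr F' (g : G₁ ⧸ Λ)) * groupLiftCM pr k Λ hpr F (g : G₁ ⧸ Λ) =
      liftPairing k (F' : Ball → ℂ) (F : Ball → ℂ) (pr g⁻¹) := by
  rw [groupLiftCM_apply_coe, groupLiftCM_apply_coe, conj_groupLift_mul_groupLift]

/-- The same with Mathlib's inner product on `ℂ` (conjugate-linear in the FIRST variable):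
`⟪groupLiftCM … F′ ⟦g⟧, groupLiftCM … F ⟦g⟧⟫_ℂ = liftPairing k F′ F (pr g⁻¹)`. [folklore] -/
theorem inner_groupLiftCM_apply
    (F' F : holFactorForms (Λ.map pr) (canonicalCocycle ℂ k)) (g : G₁) :
    inner ℂ (groupLiftCM pr k Λ hpr F' (g : G₁ ⧸ Λ)) (groupLiftCM pr k Λ hpr F (g : G₁ ⧸ Λ)) =
      liftPairing k (F' : Ball → ℂ) (F : Ball → ℂ) (pr g⁻¹) := by
  rw [← conj_groupLiftCM_mul_groupLiftCM (hpr := hpr), RCLike.inner_apply]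
  ring

/-- **Left `Δ`-invariance of the pairing integrand** for forms `F′, F` of `Δ ≤ U(2,1)`:
`liftPairing k F′ F (δ u) = liftPairing k F′ F u`. [folklore] -/
theorem liftPairing_mul_left {Δ : Subgroup U21} {F' F : Ball → ℂ}
    (hF' : F' ∈ factorForms Δ (canonicalCocycle ℂ k)) (hF : F ∈ factorForms Δ (canonicalCocycle ℂ k))
    {δ : U21} (hδ : δ ∈ Δ) (u : U21) :
    liftPairing k F' F (δ * u) = liftPairing k F' F u := by
  have h' := (toGroupFun_mem (isPullbackCocycle_canonicalCocycle ℂ k) x₀ hF').1 δ hδ u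
  have h := (toGroupFun_mem (isPullbackCocycle_canonicalCocycle ℂ k) x₀ hF).1 δ hδ u
  rw [liftPairing, liftPairing, h, h']

/-- **Continuity of the pairing integrand** for continuous `F′, F` (the canonical factor is
continuous on `U(2,1) × 𝔹²`). [folklore] -/
theorem continuous_liftPairing_of_continuous {F' F : Ball → ℂ} (hF' : Continuous F')
    (hF : Continuous F) : Continuous (liftPairing k F' F) := by
  have h : ∀ {E : Ball → ℂ}, Continuous E → Continuous (toGroupFun (canonicalCocycle ℂ k) x₀ E) :=
    fun hE => continuous_toGroupFun_scalarCocycle ((continuous_canonicalFactor x₀).pow k) hE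
  exact (Complex.continuous_conj.comp (h hF')).mul (h hF)

/-- **Continuity of the pairing integrand** for HOLOMORPHIC `F′, F`. [folklore] -/
theorem continuous_liftPairing {F' F : Ball → ℂ} (hF' : F' ∈ holomorphic ℂ)
    (hF : F ∈ holomorphic ℂ) : Continuous (liftPairing k F' F) :=
  continuous_liftPairing_of_continuous (continuous_of_mem_holomorphic hF')
    (continuous_of_mem_holomorphic hF)

end Scalar

end BallForms

end Literature.AlgebraicGeometry.ShimuraVarieties

end
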